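import Literature.NumberTheory.Automorphic.Liu2021.Def411WeilCarriersLocalIsotypy
import Literature.NumberTheory.Automorphic.UnitaryGroupDualPairLocalLine
import HarnessLib

/-!
# [Liu2021, Def. 4.11]'s `ω(μ, ε, χ)` restricted to `U(V)(F_v)` IS ISOTYPIC of type `ω(μ_v, ε_v, χ_v)` — from Lem. D.1 (1) AS PRINTED per place

Topic `NumberTheory/Automorphic/Liu2021`; namespace `Literature.NumberTheory.Automorphic.Liu2021.Def411WeilCarriers`.  KERNEL ONLY: theorems
(no definition, no named fact, no `sorry`).  Sequel of `Def411WeilCarriersLocalIsotypy` (§5: local isotypy of `rhoAtLine … ι a χ` along an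
abstract local embedding `ψ_v` with `hsq`) and `UnitaryGroupDualPairLocalLine` (`UnitaryGroup.localLineInl v : U(J_V)(F_v) →* U(J_V ⊗ (a))(F_v)`,
`k ↦ reindex e (k ⊗ 1)`, onto for a line, with `finAdelicEquiv_finPairEmb_inclPlace`): the CONSUMER FORM at Liu's own local group
`𝔾(F_v) = U(V)(F_v) = UnitaryGroup.localPi E c N J_V v`, with EXACTLY the binders of ✔ `rhoAtLine_isIrreducible_of_lemD1AsPrinted`
(the END displays' `hirr` supplier) plus the place `v` and the consumer's identification `φ'` of `U(V)(F_v)` inside `G` over the coordinate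
embedding `inclPlace v` — and NOTHING displayed beyond [Liu2021, App. D Lem. D.1 (1)] AS PRINTED per place (`hD1`): the survival clause of
Def. 4.11's `⊗'` is ✔ `survival_atLine`, the irreducibility of the local type is ✔ `LemD1OfPlace.isIrreducible_rep_of_lemD1_1AsPrinted` pulled
back along the surjection `localLineInl v`.

* `isotypicComponent_rhoAtLine_comp_eq_top_of_lemD1AsPrinted` — for `ι : G →* U(J_V)(𝔸_f)` (any), the local-global factorisation `hfac` of
  `s_a` through the local splittings `𝓢`, Step 2's characters `μ_v`, `3 ≤ n`, `hD1 v` for every `v`, a place `v` and `φ' : U(J_V)(F_v) →* G` with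
  `ι ∘ φ' = inclPlace v`: the `ℂ[U(J_V)(F_v)]`-module of `rhoAtLine … ι a χ ∘ φ'` is the sum of its submodules isomorphic to
  `Coinv(ω_v ∘ (u ↦ u·1_n), χ_v) ∘ (k ↦ k ⊗ 1)` — the LOCAL ISOTYPY `hiso` of ✔ `Liu2021.hsep_of_lemD1AsPrinted` ∕
  ✔ `Literature.RepresentationTheory.Liu2021.chr_eq_of_equiv` («Statement (2) follows from Lemma D.1», [Liu2021] l. 2270) for the
  CONSTRUCTED carriers, read on `U(V)(F_v)`;
* `isotypicComponent_rho_comp_eq_top_of_lemD1AsPrinted` — the instance `a := lineOf ε` (`rho_eq_rhoAtLine`, `rfl`).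

Nothing of [Liu2021] is asserted (Lem. D.1 (1) enters only as the hypothesis `LemD1_1AsPrinted (…)`); HC_CM is NOT proved and not mentioned
further; «Δ2 BRIDGE CLOSED» is NOT claimed.  Cell pub-hodgecm2 (COR-CM), Δ2 BRIDGE cite legs `hsepW` ∕ `hμsep`; seat prover-pub-hodgecm2-b10-g68-0.

## References
* [Liu2021] Y. Liu, Camb. J. Math. 9 (2021) = arXiv:2102.11518: Def. 4.11 (l. 2090–2096), App. D §D.1 Steps 1∕2∕3 (l. 5217∕5219∕5221),
  Lem. D.1 (l. 5227; (1) l. 5229; (3) l. 5233), Thm. 4.18 (2) and its proof (l. 2241, 2270).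
* [Flath1979] D. Flath, PSPM 33 (1979) part 1, §2 Ex. 2, Thm. 3 (uniqueness clause).
* [GelbartRogawski1991] S. Gelbart, J. Rogawski, Invent. Math. 105 (1991), §3.1 Prop. 3.1.1 p. 455 L1–3, §3.2 p. 457.
-/

set_option autoImplicit false

noncomputable section

open scoped Matrix Kronecker RestrictedProduct NumberField Classical
open NumberField IsDedekindDomain Filter Set
open Literature.NumberTheory Literature.NumberTheory.Automorphic Literature.NumberTheory.Automorphic.UnitaryGroup
open Literature.NumberTheory.GelbartRogawski1991 Literature.NumberTheory.GelbartRogawski1991.UnitaryDualPair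
open Literature.NumberTheory.GelbartRogawski1991.UnitaryDualPair.WeilCoinv
open Literature.NumberTheory.Weil1964 Literature.RepresentationTheory

namespace Literature.NumberTheory.Automorphic.Liu2021.Def411WeilCarriers

variable (F E : Type) [Field F] [NumberField F] [Field E] [NumberField E] [Algebra F E]
variable (c : E ≃ₐ[F] E) (N : ℕ) {n : ℕ} (e : Fin N × Fin 1 ≃ Fin n)
variable (JV : Matrix (Fin N) (Fin N) E) {TV : Matrix (Fin N) (Fin N) F}
variable [Algebra.IsQuadraticExtension F E] {δ : E} (hcδ : c δ = -δ) (hδ : δ ≠ 0) {d : F} (hd : δ * δ = algebraMap F E d)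

/-- **[Liu2021, Def. 4.11] `ω(μ, ε, χ) := ⊗'_v ω(μ_v, ε_v, χ_v)` restricted to `U(V)(F_v)` is ISOTYPIC of type `ω(μ_v, ε_v, χ_v)` — from
[App. D, Lem. D.1 (1)] AS PRINTED per place.**  For a compatible splitting family `s` of the pair data `(V, ⟨a⟩)` whose member `s_a` FACTORS
through the local reference section of the local splittings `𝓢` (`hfac`), Step 2's characters `μ_v`, `3 ≤ n`, the per-place AS-PRINTED
cite `hD1 v : LemD1_1AsPrinted (localLemD1Data … a 𝓢 … χ … v)`, any `ι : G →* U(J_V)(𝔸_f)` and any `φ' : U(J_V)(F_v) →* G` over the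
coordinate embedding of the place `v` (`hφ'`): the `ℂ[U(J_V)(F_v)]`-module of `rhoAtLine … ι a χ ∘ φ'` is the sum of its submodules
isomorphic to the local central `χ_v`-quotient of `ω_v` pulled back along `k ↦ reindex (k ⊗ 1)` (Mathlib `isotypicComponent … = ⊤`; the
survival clause is ✔ `survival_atLine`, the irreducibility of the type is Lem. D.1 (1) + `n ≥ 3` via ✔
`LemD1OfPlace.isIrreducible_rep_of_lemD1_1AsPrinted` and the surjectivity of `localLineInl v`).
[cite: Liu2021, Def. 4.11 (l. 2090–2096), App. D §D.1 Steps 1∕2∕3 (l. 5217∕5219∕5221), Lem. D.1 (l. 5227; (1) l. 5229), Thm. 4.18 (2) with proof l. 2270; Flath1979, §2 Example 2 and Theorem 3 (uniqueness clause); GelbartRogawski1991, §3.1 Prop. 3.1.1 p. 455 L1–3, §3.2 p. 457] -/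
theorem isotypicComponent_rhoAtLine_comp_eq_top_of_lemD1AsPrinted (hV : TV.IsSymm) (hVd : IsUnit TV.det)
    (hJV : JV = TV.map (algebraMap F E))
    {s : ∀ a : Fˣ, UnitaryGroup.adelicPair F E c N 1 JV (JW F E a) →* adelicMpCont F (Fin n) (adelicGram F e TV (TW F a))}
    (hs : ∀ a : Fˣ, (splittingDatum F E c N 1 e JV (JW F E a) hcδ hδ hd hV (isSymm_TW F a) hVd (isUnit_det_TW F a) hJV
      (JW_eq F E a)).IsCompatible (s a))
    (a : Fˣ) (χ : Chi F E c)
    (𝓢 : LocalSplitting.FinLocalSplittings F E c n hcδ hδ hd (gram F e TV (TW F a)) (isSymm_gram F e hV (isSymm_TW F a))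
      (reindex_kronecker_eq_gram_map F E e hJV (JW_eq F E a)))
    {G : Type*} [Group G] (ι : G →* UnitaryGroup.finAdelic F E c N JV)
    (hfac : (pairSmall₁ F E c N 1 e JV (JW F E a) (s a)).comp (finPairToAdelic F E c N 1 JV (JW F E a)) =
      localRefSection F E c N 1 e JV (JW F E a) hcδ hδ hd hV (isSymm_TW F a) hJV (JW_eq F E a) 𝓢)
    (hn : 3 ≤ n)
    (μ : ∀ v : HeightOneSpectrum (𝓞 F), (LocalRing E v)ˣ →* ℂˣ) (hμn : ∀ v x, ‖((μ v x : ℂˣ) : ℂ)‖ = 1)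
    (hμc : ∀ v, Continuous fun x => ((μ v x : ℂˣ) : ℂ))
    (hμF : ∀ (v : HeightOneSpectrum (𝓞 F)) (t : (v.adicCompletion F)ˣ),
      μ v (Units.map (algebraMap (v.adicCompletion F) (LocalRing E v)).toMonoidHom t) = 1 ↔
        ∃ x : (LocalRing E v)ˣ, (x : LocalRing E v) * conjLocal E c v x =
          algebraMap (v.adicCompletion F) (LocalRing E v) t)
    (hD1 : ∀ v, LemD1_1AsPrinted
      (localLemD1Data F E c N e JV hcδ hδ hd hV hVd hJV a 𝓢 hn μ hμn hμc hμF χ.1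
        (norm_chi_eq_one F E c (Algebra.IsQuadraticExtension.finrank_eq_two F E)
          (UnitaryGroup.algEquiv_ne_one_of_apply_eq_neg F E c hcδ hδ) χ) χ.2.1 v))
    (v : HeightOneSpectrum (𝓞 F)) (φ' : UnitaryGroup.localPi E c N JV v →* G)
    (hφ' : ∀ g, ι (φ' g) = UnitaryGroup.inclPlace F E c N JV v g) :
    isotypicComponent (MonoidAlgebra ℂ (UnitaryGroup.localPi E c N JV v))
      (Representation.asModule ((rhoAtLine F E c N e JV hcδ hδ hd hV hVd hJV hs ι a χ).comp φ'))
      (Representation.asModule (show Representation ℂ (UnitaryGroup.localPi E c N JV v) _ from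
        (TwistedCoinv.rep (localCharOfCenter F E c (JW F E a) (JW_apply_ne_zero F E a) χ.1 v) (𝓢.omegaLoc v)
          (commute_omegaLoc_localCenter F E c N e JV (JW F E a) hcδ hδ hd hV (isSymm_TW F a) hJV (JW_eq F E a)
            (JW_apply_ne_zero F E a) 𝓢 v)).comp (UnitaryGroup.localLineInl E c N e JV (JW F E a) v))) = ⊤ := by
  haveI : NeZero n := ⟨by omega⟩
  -- the local type is irreducible: Lem. D.1 (1) AS PRINTED at `v` (+ `n ≥ 3`), pulled back along the onto map `k ↦ reindex (k ⊗ 1)`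
  haveI hirr0 := LemD1OfPlace.isIrreducible_rep_of_lemD1_1AsPrinted E v c n (Matrix.reindex e e (JV ⊗ₖ JW F E a))
    hcδ hδ (Nat.le_of_succ_le hn) (reindex_kronecker_JW_hermitian F E c N e JV hV hJV a)
    (det_reindex_kronecker_JW_ne_zero F E N e JV hVd hJV a) (JW F E a) (𝓢.omegaLoc v) (μ v) (hμn v)
    (hμc v) (hμF v) (localCharOfCenter F E c (JW F E a) (JW_apply_ne_zero F E a) χ.1 v)
    (norm_localCharOfCenter F E c (JW F E a) (JW_apply_ne_zero F E a)
      (norm_chi_eq_one F E c (Algebra.IsQuadraticExtension.finrank_eq_two F E)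
        (UnitaryGroup.algEquiv_ne_one_of_apply_eq_neg F E c hcδ hδ) χ) v)
    (continuous_coe_localCharOfCenter F E c (JW F E a) (JW_apply_ne_zero F E a) χ.2.1 v)
    (JW_apply_ne_zero F E a)
    (commute_omegaLoc_localCenter F E c N e JV (JW F E a) hcδ hδ hd hV (isSymm_TW F a) hJV
      (JW_eq F E a) (JW_apply_ne_zero F E a) 𝓢 v)
    (hD1 v) hn
  haveI : (show Representation ℂ (UnitaryGroup.localPi E c N JV v) _ from
      (TwistedCoinv.rep (localCharOfCenter F E c (JW F E a) (JW_apply_ne_zero F E a) χ.1 v) (𝓢.omegaLoc v)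
        (commute_omegaLoc_localCenter F E c N e JV (JW F E a) hcδ hδ hd hV (isSymm_TW F a) hJV (JW_eq F E a)
          (JW_apply_ne_zero F E a) 𝓢 v)).comp (UnitaryGroup.localLineInl E c N e JV (JW F E a) v)).IsIrreducible :=
    (Representation.isIrreducible_comp_iff_of_surjective _ _ (UnitaryGroup.localLineInl_surjective E c N e JV (JW F E a) (JW_apply_ne_zero F E a) v)).2
      hirr0
  refine isotypicComponent_rhoAtLine_comp_eq_top_of_factors F E c N e JV hcδ hδ hd hV hVd hJV hs a χ 𝓢
    (fun w => UnitaryGroup.localLineInl E c N e JV (JW F E a) w)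
    (UnitaryGroup.eventually_localLineInl_mapsTo_localInt E c N e JV (JW F E a)) ι hfac
    (survival_atLine F E c N e JV hcδ hδ hd hV hVd hJV a χ 𝓢) v φ' fun g => ?_
  rw [hφ']
  exact UnitaryGroup.finAdelicEquiv_finPairEmb_inclPlace E c N e JV (JW F E a) v g

/-- **The same for the tree's `rho … ι ε χ`** (the instance `a := lineOf ε`: `rho_eq_rhoAtLine`, `rfl`): EXACTLY the binders of
✔ `rho_isIrreducible_of_lemD1AsPrinted'` plus the place `v` and `φ'` over `inclPlace v`.
[cite: Liu2021, Def. 4.11 (l. 2090–2096), App. D Lem. D.1 (l. 5227; (1) l. 5229), Thm. 4.18 (2) with proof l. 2270; Flath1979, Theorem 3 (uniqueness clause)] -/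
theorem isotypicComponent_rho_comp_eq_top_of_lemD1AsPrinted (hV : TV.IsSymm) (hVd : IsUnit TV.det)
    (hJV : JV = TV.map (algebraMap F E))
    {s : ∀ a : Fˣ, UnitaryGroup.adelicPair F E c N 1 JV (JW F E a) →* adelicMpCont F (Fin n) (adelicGram F e TV (TW F a))}
    (hs : ∀ a : Fˣ, (splittingDatum F E c N 1 e JV (JW F E a) hcδ hδ hd hV (isSymm_TW F a) hVd (isUnit_det_TW F a) hJV
      (JW_eq F E a)).IsCompatible (s a))
    (ε : Eps F d) (χ : Chi F E c)
    (𝓢 : LocalSplitting.FinLocalSplittings F E c n hcδ hδ hd (gram F e TV (TW F (lineOf F d ε)))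
      (isSymm_gram F e hV (isSymm_TW F (lineOf F d ε))) (reindex_kronecker_eq_gram_map F E e hJV (JW_eq F E (lineOf F d ε))))
    {G : Type*} [Group G] (ι : G →* UnitaryGroup.finAdelic F E c N JV)
    (hfac : (pairSmall₁ F E c N 1 e JV (JW F E (lineOf F d ε)) (s (lineOf F d ε))).comp
        (finPairToAdelic F E c N 1 JV (JW F E (lineOf F d ε))) =
      localRefSection F E c N 1 e JV (JW F E (lineOf F d ε)) hcδ hδ hd hV (isSymm_TW F _) hJV (JW_eq F E _) 𝓢)
    (hn : 3 ≤ n)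
    (μ : ∀ v : HeightOneSpectrum (𝓞 F), (LocalRing E v)ˣ →* ℂˣ) (hμn : ∀ v x, ‖((μ v x : ℂˣ) : ℂ)‖ = 1)
    (hμc : ∀ v, Continuous fun x => ((μ v x : ℂˣ) : ℂ))
    (hμF : ∀ (v : HeightOneSpectrum (𝓞 F)) (t : (v.adicCompletion F)ˣ),
      μ v (Units.map (algebraMap (v.adicCompletion F) (LocalRing E v)).toMonoidHom t) = 1 ↔
        ∃ x : (LocalRing E v)ˣ, (x : LocalRing E v) * conjLocal E c v x =
          algebraMap (v.adicCompletion F) (LocalRing E v) t)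
    (hD1 : ∀ v, LemD1_1AsPrinted
      (localLemD1Data F E c N e JV hcδ hδ hd hV hVd hJV (lineOf F d ε) 𝓢 hn μ hμn hμc hμF χ.1
        (norm_chi_eq_one F E c (Algebra.IsQuadraticExtension.finrank_eq_two F E)
          (UnitaryGroup.algEquiv_ne_one_of_apply_eq_neg F E c hcδ hδ) χ) χ.2.1 v))
    (v : HeightOneSpectrum (𝓞 F)) (φ' : UnitaryGroup.localPi E c N JV v →* G)
    (hφ' : ∀ g, ι (φ' g) = UnitaryGroup.inclPlace F E c N JV v g) :
    isotypicComponent (MonoidAlgebra ℂ (UnitaryGroup.localPi E c N JV v))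
      (Representation.asModule ((rho F E c N e JV hcδ hδ hd hV hVd hJV hs ι ε χ).comp φ'))
      (Representation.asModule (show Representation ℂ (UnitaryGroup.localPi E c N JV v) _ from
        (TwistedCoinv.rep (localCharOfCenter F E c (JW F E (lineOf F d ε)) (JW_apply_ne_zero F E _) χ.1 v) (𝓢.omegaLoc v)
          (commute_omegaLoc_localCenter F E c N e JV (JW F E (lineOf F d ε)) hcδ hδ hd hV (isSymm_TW F _) hJV (JW_eq F E _)
            (JW_apply_ne_zero F E _) 𝓢 v)).comp (UnitaryGroup.localLineInl E c N e JV (JW F E (lineOf F d ε)) v))) = ⊤ :=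
  isotypicComponent_rhoAtLine_comp_eq_top_of_lemD1AsPrinted F E c N e JV hcδ hδ hd hV hVd hJV hs (lineOf F d ε) χ 𝓢 ι hfac hn μ
    hμn hμc hμF hD1 v φ' hφ'

end Literature.NumberTheory.Automorphic.Liu2021.Def411WeilCarriers

end
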